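import Literature.Algebra.Homology.GroupHomologyPermutationModuleInvariants
import Literature.LinearAlgebra.Matrix.SpecialLinearReductionSurjective
import Mathlib.NumberTheory.ModularForms.CongruenceSubgroups
import Mathlib.LinearAlgebra.Matrix.GeneralLinearGroup.Defs
import Mathlib.GroupTheory.GroupAction.Quotient
import Mathlib.Algebra.Field.ZMod
import HarnessLib

/-!
# The full-level homology carrier `H₁(Y(K(p)K₀(M)), k) = H₁(Γ₀(M), k[GL₂(ℤ/p)])` with its `GL₂(ℤ/p)`-action;
# the torus level `Γ_T`, and transitivity of `Γ₀(M)` on `GL₂(ℤ/p)/T̃`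

Topic `Literature/NumberTheory/ModularSymbols`; namespace `Literature.NumberTheory.ModularSymbols.FullLevel`.
Definitions with bodies + proved theorems; no named fact, no `sorry`, no instance, no notation.

## The carrier (Ash–Stevens 1986 §1; Diamond–Shurman §1.2, §1.5)

For `p ∤ M` the open modular curve of level `K(p)K₀(M)` (full level `p`, `Γ₀(M)`-level away from `p`) is
`Y(K(p)K₀(M))(ℂ) = GL₂(ℚ)\(ℍ^± × GL₂(𝔸_f))/K(p)K₀(M) = Γ₀(M) \ (ℍ × GL₂(ℤ/p))`, `Γ₀(M)` acting diagonally (on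
`GL₂(ℤ/p)` by left multiplication through reduction mod `p`), freely for `p ≥ 3`; it has `p − 1` components
`Γ(p) ∩ Γ₀(M) \ ℍ` indexed by `det`, and `GL₂(ℤ/p)` acts on the right.  By the Borel construction its homology is
GROUP HOMOLOGY WITH PERMUTATION COEFFICIENTS, which is what this file DEFINES (the topological identification
is the docstring's, not a theorem of the tree):

* `redGL p M : Γ₀(M) →* GL₂(ℤ/p)` (reduction), `coeff k p M : Rep k Γ₀(M)` (= `k[GL₂(ℤ/p)]`,
  `PermutationCoeff.permRepObj`), **`H1carrier k p M = H₁(Γ₀(M), k[GL₂(ℤ/p)])`** (Mathlib `groupHomology.H1`)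
  and **`H1carrierRep k p M : Representation k GL₂(ℤ/p) (H1carrier k p M)`** (right translation;
  `PermutationCoeff.H1RightRep`).
* `principalLevel p M = Γ(p) ∩ Γ₀(M)` (kernel of `redGL`; `mem_principalLevel_iff`) = every point stabilizer
  (`stabilizerIn_eq_principalLevel`), so by `GroupHomologyPermutationModuleShapiro` each component contributes
  `H₁(Γ(p) ∩ Γ₀(M), k)`.
* `diagTorus F ≤ GL₂(F)` (diagonal torus `T̃`), `torusLevel p M = Γ_T = {γ ∈ Γ₀(M) : γ ≡ diag (mod p)}`
  (`mem_torusLevel_iff`: `p ∣ b ∧ p ∣ c`) — the stabilizer of the coset `T̃`; `Y(K(p)K₀(M))/T̃ ≅ X₀(p²M)ᵒ` since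
  `Γ_T = diag(p,1) Γ₀(p²M) diag(p,1)⁻¹` (the conjugation is the sequel's `FullLevelHomologyTorusLevelConj`).
* **`exists_redGL_eq_toGL`**: for `gcd(p, M) = 1` every `s ∈ SL₂(ℤ/p)` is `redGL γ` for some `γ ∈ Γ₀(M)`
  (CRT on entries + the tree's `SL₂(ℤ) ↠ SL₂(ℤ/pM)`, `IntegerSpecialLinear.exists_specialLinearGroup_intModEq`,
  Andrianov–Zhuravlev Ch. 3 Lemma 3.2); **`redGL_smul_one_surjective`**: `Γ₀(M)` acts TRANSITIVELY on
  `GL₂(ℤ/p)/T̃` (`GL₂ = SL₂·T̃`: `g · diag(1, det g)⁻¹ ∈ SL₂`).  With `GroupHomologyPermutationModuleShapiro`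
  and `…Invariants` this gives the up/down dictionary `H₁(Y, k)^{T̃} ≅ H₁(Γ₀(M), k[G/T̃]) ≅ H₁(Γ_T, k)`
  (assembled in the sequel).

Consumer: route BSD/TeichmullerTwistDescent, crux `TwistedPeriodLatticeSaturation` (stmt 25368): this is the
carrier `Λ′ = H₁(Y_full, ℤ_p)` of the composed K-line (memo KLINE-COMPOSED §2 (D1), audit (S2)–(S3)); the
automorphic type (I1) and the weights-in-cohomology facts (I3)(I4) are statements ABOUT this object and are not
asserted here.  Nothing about any elliptic curve is asserted.

## References
* A. Ash, G. Stevens, *Modular forms in characteristic ℓ and special values of their L-functions*, Duke Math.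
  J. 53 (1986), §1 (1.1)–(1.3) (homology of `Γ` with coefficients; the `GL₂(ℤ/p)`-module structure). [AshStevens1986]
* F. Diamond, J. Shurman, *A First Course in Modular Forms*, GTM 228 (2005), §1.2 (congruence subgroups,
  reduction `SL₂(ℤ) → SL₂(ℤ/N)` onto), §1.5 and Exercise 1.2.2. [DiamondShurman2005]
* A. N. Andrianov, V. G. Zhuravlev, *Modular Forms and Hecke Operators* (1995), Ch. 3 Lemma 3.2 (1). [AndrianovZhuravlev2015]
* D. Bump, *Automorphic Forms and Representations* (1997), §4.1 (the torus `T(F)`, `GL₂ = SL₂ · T`). [Bump1997]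
-/

noncomputable section

namespace Literature.NumberTheory.ModularSymbols

namespace FullLevel

open scoped MatrixGroups
open CategoryTheory CongruenceSubgroup groupHomology Finsupp Matrix
open Literature.Algebra.Homology

variable (k : Type) [CommRing k] (p M : ℕ)

/-! ### Reduction modulo `p` on `Γ₀(M)` and the full-level carrier -/

/-- Reduction modulo `p`: `Γ₀(M) → SL₂(ℤ) → SL₂(ℤ/p) → GL₂(ℤ/p)`. [cite: DiamondShurman2005, §1.2] -/
def redGL : Gamma0 M →* GL (Fin 2) (ZMod p) :=
  (Matrix.SpecialLinearGroup.toGL).comp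
    ((Matrix.SpecialLinearGroup.map (Int.castRingHom (ZMod p))).comp (Gamma0 M).subtype)

/-- Entries of the reduction. [cite: DiamondShurman2005, §1.2] -/
theorem redGL_apply_coe (γ : Gamma0 M) (i j : Fin 2) :
    ((redGL p M γ : GL (Fin 2) (ZMod p)) : Matrix (Fin 2) (Fin 2) (ZMod p)) i j =
      (((γ : SL(2, ℤ)) : Matrix (Fin 2) (Fin 2) ℤ) i j : ZMod p) := by
  simp [redGL]

/-- **The full-level coefficient representation** `k[GL₂(ℤ/p)]` of `Γ₀(M)` (left translation through
reduction mod `p`). Its group homology in degree one is `H₁(Y(K(p)K₀(M))(ℂ), k)`: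
`Y(K(p)K₀(M))(ℂ) = Γ₀(M) \ (ℍ × GL₂(ℤ/p))` with `Γ₀(M)` acting diagonally (freely, `p ≥ 3`), so by the Borel
construction `H_*(Y, k) = H_*(Γ₀(M), k[GL₂(ℤ/p)])`; `GL₂(ℤ/p)` acts on the right.
[cite: AshStevens1986, §1 (1.1)–(1.3)] -/
abbrev coeff : Rep k (Gamma0 M) := PermutationCoeff.permRepObj k (redGL p M) (GL (Fin 2) (ZMod p))

/-- **The full-level homology carrier** `H₁(Γ₀(M), k[GL₂(ℤ/p)]) = H₁(Y(K(p)K₀(M)), k)`.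
[cite: AshStevens1986, §1 (1.1)–(1.3)] -/
abbrev H1carrier : ModuleCat k := groupHomology.H1 (coeff k p M)

/-- The `GL₂(ℤ/p)`-action on the carrier (right translation on `Y(K(p)K₀(M))`).
[cite: AshStevens1986, §1 (1.2)] -/
abbrev H1carrierRep : Representation k (GL (Fin 2) (ZMod p)) (H1carrier k p M) :=
  PermutationCoeff.H1RightRep k (redGL p M)

/-! ### The principal level `Γ(p) ∩ Γ₀(M)` = every stabilizer -/

/-- `Γ(p) ∩ Γ₀(M)` as a subgroup of `Γ₀(M)`: the kernel of reduction mod `p`. [cite: DiamondShurman2005, §1.2] -/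
def principalLevel : Subgroup (Gamma0 M) := (redGL p M).ker

/-- `γ ∈ Γ(p) ∩ Γ₀(M)` iff `γ ∈ Γ(p)` (Mathlib's `Gamma p`). [cite: DiamondShurman2005, §1.2] -/
theorem mem_principalLevel_iff (γ : Gamma0 M) : γ ∈ principalLevel p M ↔ (γ : SL(2, ℤ)) ∈ Gamma p := by
  rw [principalLevel, MonoidHom.mem_ker, Gamma_mem']
  simp only [redGL, MonoidHom.coe_comp, Function.comp_apply, Subgroup.coe_subtype]
  constructor
  · intro h
    exact Matrix.SpecialLinearGroup.toGL_injective (by simpa using h)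
  · intro h
    change Matrix.SpecialLinearGroup.toGL
        (Matrix.SpecialLinearGroup.map (Int.castRingHom (ZMod p)) (γ : SL(2, ℤ))) = 1
    rw [h, map_one]

/-- Every point stabilizer of the left translation action is `Γ(p) ∩ Γ₀(M)`. [cite: AshStevens1986, §1] -/
theorem stabilizerIn_eq_principalLevel (x : GL (Fin 2) (ZMod p)) :
    PermutationCoeff.stabilizerIn (redGL p M) x = principalLevel p M := by
  ext γ
  rw [PermutationCoeff.mem_stabilizerIn_iff, principalLevel, MonoidHom.mem_ker, smul_eq_mul,
    mul_eq_right]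

/-! ### The diagonal torus `T̃ ≤ GL₂(ℤ/p)` and the torus level `Γ_T = {γ ≡ diag mod p}` -/

/-- The diagonal torus `T̃ = {diag(a, d)} ≤ GL₂(F)`. [cite: Bump1997, §4.1 Eq. (1.6)] -/
def diagTorus (F : Type) [Field F] : Subgroup (GL (Fin 2) F) where
  carrier := {g | (g : Matrix (Fin 2) (Fin 2) F) 0 1 = 0 ∧ (g : Matrix (Fin 2) (Fin 2) F) 1 0 = 0}
  mul_mem' {g h} hg hh := by
    simp only [Set.mem_setOf_eq, Units.val_mul, Matrix.mul_apply, Fin.sum_univ_two] at *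
    rw [hg.1, hh.1, hg.2, hh.2]
    simp
  one_mem' := by simp
  inv_mem' {g} hg := by
    simp only [Set.mem_setOf_eq] at *
    rw [Matrix.coe_units_inv, Matrix.inv_def, Matrix.adjugate_fin_two]
    simp [hg.1, hg.2]

variable {p M} in
/-- Membership in the diagonal torus. [cite: Bump1997, §4.1 Eq. (1.6)] -/
theorem mem_diagTorus_iff {F : Type} [Field F] (g : GL (Fin 2) F) :
    g ∈ diagTorus F ↔ (g : Matrix (Fin 2) (Fin 2) F) 0 1 = 0 ∧ (g : Matrix (Fin 2) (Fin 2) F) 1 0 = 0 :=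
  Iff.rfl

/-- **The torus level** `Γ_T = {γ ∈ Γ₀(M) : γ ≡ diag (mod p)}` = the stabilizer of the coset `T̃` of
`GL₂(ℤ/p)/T̃` — the group of `X₀(p²M) ≅ Y(K(p)K₀(M))/T̃` (conjugate to `Γ₀(p²M)` by `diag(p, 1)`).
[cite: DiamondShurman2005, §1.5 (conjugate congruence subgroups)] -/
def torusLevel [Fact p.Prime] : Subgroup (Gamma0 M) :=
  PermutationCoeff.stabilizerIn (redGL p M) ((1 : GL (Fin 2) (ZMod p)) : GL (Fin 2) (ZMod p) ⧸ diagTorus (ZMod p))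

/-- `γ ∈ Γ_T ↔ p ∣ b ∧ p ∣ c`. [cite: DiamondShurman2005, §1.5] -/
theorem mem_torusLevel_iff [Fact p.Prime] (γ : Gamma0 M) :
    γ ∈ torusLevel p M ↔ ((((γ : SL(2, ℤ)) : Matrix (Fin 2) (Fin 2) ℤ) 0 1 : ℤ) : ZMod p) = 0 ∧
      ((((γ : SL(2, ℤ)) : Matrix (Fin 2) (Fin 2) ℤ) 1 0 : ℤ) : ZMod p) = 0 := by
  rw [torusLevel, PermutationCoeff.mem_stabilizerIn_iff, MulAction.Quotient.smul_coe, smul_eq_mul, mul_one,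
    QuotientGroup.eq, mul_one, inv_mem_iff, mem_diagTorus_iff, redGL_apply_coe, redGL_apply_coe]



/-! ### `Γ₀(M) → SL₂(ℤ/p)` is onto when `gcd(p, M) = 1` (CRT + `SL₂(ℤ) ↠ SL₂(ℤ/pM)`) -/

/-- **Strong approximation at one prime for `Γ₀(M)`**: if `gcd(p, M) = 1`, every `s ∈ SL₂(ℤ/p)` is the
reduction of some `γ ∈ Γ₀(M)` (indeed of a `γ ≡ 1 mod M`).  Proof: CRT on the entries, then lift a matrix of
determinant `≡ 1 (mod pM)` to `SL₂(ℤ)` (Andrianov–Zhuravlev Ch. 3 Lemma 3.2 (1), the tree's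
`exists_specialLinearGroup_intModEq`). [cite: DiamondShurman2005, Exercise 1.2.2 and §1.2] -/
theorem exists_redGL_eq_toGL [NeZero p] (hpM : Nat.Coprime p M) (s : SL(2, ZMod p)) :
    ∃ γ : Gamma0 M, redGL p M γ = Matrix.SpecialLinearGroup.toGL s := by
  -- entrywise CRT
  have crt : ∀ i j : Fin 2, ∃ a : ℕ, a ≡ ((s : Matrix (Fin 2) (Fin 2) (ZMod p)) i j).val [MOD p] ∧
      a ≡ (if i = j then 1 else 0) [MOD M] := fun i j =>
    let c := Nat.chineseRemainder hpM ((s : Matrix (Fin 2) (Fin 2) (ZMod p)) i j).val (if i = j then 1 else 0)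
    ⟨c.1, c.2.1, c.2.2⟩
  choose a ha using crt
  let A : Matrix (Fin 2) (Fin 2) ℤ := fun i j => (a i j : ℤ)
  have hAp : ∀ i j, ((A i j : ℤ) : ZMod p) = (s : Matrix (Fin 2) (Fin 2) (ZMod p)) i j := fun i j => by
    simp only [A, Int.cast_natCast]
    rw [(ZMod.natCast_eq_natCast_iff' _ _ _).2 (ha i j).1, ZMod.natCast_zmod_val]
  have hAM : ∀ i j, ((A i j : ℤ) : ZMod M) = (if i = j then 1 else 0) := fun i j => by
    simp only [A, Int.cast_natCast]
    rw [(ZMod.natCast_eq_natCast_iff' _ _ _).2 (ha i j).2]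
    split_ifs <;> simp
  have hmapp : A.map (Int.castRingHom (ZMod p)) = (s : Matrix (Fin 2) (Fin 2) (ZMod p)) := by
    ext i j; simpa using hAp i j
  have hmapM : A.map (Int.castRingHom (ZMod M)) = 1 := by
    ext i j
    rw [Matrix.map_apply, eq_intCast, hAM, Matrix.one_apply]
  have hdetp : ((A.det : ℤ) : ZMod p) = 1 := by
    have h := RingHom.map_det (Int.castRingHom (ZMod p)) A
    rw [eq_intCast] at h
    rw [h, RingHom.mapMatrix_apply, hmapp, Matrix.SpecialLinearGroup.det_coe]
  have hdetM : ((A.det : ℤ) : ZMod M) = 1 := by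
    have h := RingHom.map_det (Int.castRingHom (ZMod M)) A
    rw [eq_intCast] at h
    rw [h, RingHom.mapMatrix_apply, hmapM, Matrix.det_one]
  have hdvdp : (p : ℤ) ∣ A.det - 1 := by
    rw [← ZMod.intCast_zmod_eq_zero_iff_dvd, Int.cast_sub, Int.cast_one, hdetp, sub_self]
  have hdvdM : (M : ℤ) ∣ A.det - 1 := by
    rw [← ZMod.intCast_zmod_eq_zero_iff_dvd, Int.cast_sub, Int.cast_one, hdetM, sub_self]
  have hdvd : ((p * M : ℕ) : ℤ) ∣ A.det - 1 := by
    rw [Nat.cast_mul]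
    exact (Nat.Coprime.isCoprime hpM |> Int.isCoprime_iff_gcd_eq_one.1 |> fun h =>
      Int.isCoprime_iff_gcd_eq_one.2 h).mul_dvd hdvdp hdvdM
  have hdet : A.det ≡ 1 [ZMOD (p * M : ℕ)] := (Int.ModEq.symm ((Int.modEq_iff_dvd).2 (by simpa using hdvd)))
  obtain ⟨V, hV⟩ :=
    Literature.LinearAlgebra.Matrix.IntegerSpecialLinear.exists_specialLinearGroup_intModEq (p * M) A hdet
  -- `V ∈ Γ₀(M)`
  have hVM : ∀ i j, (((V : Matrix (Fin 2) (Fin 2) ℤ) i j : ℤ) : ZMod M) = (if i = j then 1 else 0) :=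
    fun i j => by
      rw [← hAM, eq_comm]
      exact (ZMod.intCast_eq_intCast_iff _ _ _).2 ((hV i j).of_mul_left p)
  have hVp : ∀ i j, (((V : Matrix (Fin 2) (Fin 2) ℤ) i j : ℤ) : ZMod p) =
      (s : Matrix (Fin 2) (Fin 2) (ZMod p)) i j := fun i j => by
    rw [← hAp, eq_comm]
    exact (ZMod.intCast_eq_intCast_iff _ _ _).2 ((hV i j).of_mul_right M)
  have hV0 : V ∈ Gamma0 M := by
    rw [Gamma0_mem]
    simpa using hVM 1 0
  refine ⟨⟨V, hV0⟩, ?_⟩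
  refine Matrix.GeneralLinearGroup.ext fun i j => ?_
  rw [redGL_apply_coe]
  exact hVp i j

/-- The torus element `diag(1, u)`. [cite: Bump1997, §4.1 Eq. (1.6)] -/
def diagOneUnit {F : Type} [Field F] (u : Fˣ) : GL (Fin 2) F :=
  Matrix.GeneralLinearGroup.mkOfDetNeZero !![(1 : F), 0; 0, (u : F)]
    (by simp [Matrix.det_fin_two_of, u.ne_zero])

/-- Matrix of `diag(1, u)`. [cite: Bump1997, §4.1 Eq. (1.6)] -/
theorem coe_diagOneUnit {F : Type} [Field F] (u : Fˣ) :
    (diagOneUnit u : Matrix (Fin 2) (Fin 2) F) = !![(1 : F), 0; 0, (u : F)] := rfl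

/-- `diag(1, u) ∈ T̃`. [cite: Bump1997, §4.1 Eq. (1.6)] -/
theorem diagOneUnit_mem_diagTorus {F : Type} [Field F] (u : Fˣ) : diagOneUnit u ∈ diagTorus F := by
  rw [mem_diagTorus_iff, coe_diagOneUnit]
  simp

/-- For `g ∈ GL₂(F)`, `g · diag(1, (det g)⁻¹)` has determinant `1` (`GL₂ = SL₂ · T̃`). [cite: Bump1997, §4.1] -/
theorem det_mul_diagOneUnit_inv {F : Type} [Field F] (g : GL (Fin 2) F) :
    ((g * diagOneUnit (Matrix.GeneralLinearGroup.det g)⁻¹ : GL (Fin 2) F) : Matrix (Fin 2) (Fin 2) F).det = 1 := by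
  rw [Units.val_mul, Matrix.det_mul, coe_diagOneUnit, Matrix.det_fin_two_of]
  simp only [Units.val_inv_eq_inv_val, Matrix.GeneralLinearGroup.val_det_apply, mul_zero, sub_zero, one_mul]
  exact mul_inv_cancel₀ (by
    simpa [Matrix.GeneralLinearGroup.val_det_apply] using (Matrix.GeneralLinearGroup.det g).ne_zero)

/-- **`Γ₀(M)` acts transitively on `GL₂(ℤ/p)/T̃`** (`gcd(p, M) = 1`): `GL₂ = SL₂ · T̃` and `Γ₀(M) ↠ SL₂(ℤ/p)`.
[cite: DiamondShurman2005, §1.2, §1.5] -/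
theorem redGL_smul_one_surjective [Fact p.Prime] (hpM : Nat.Coprime p M)
    (q : GL (Fin 2) (ZMod p) ⧸ diagTorus (ZMod p)) :
    ∃ γ : Gamma0 M, redGL p M γ • ((1 : GL (Fin 2) (ZMod p)) : GL (Fin 2) (ZMod p) ⧸ diagTorus (ZMod p)) = q := by
  induction q using QuotientGroup.induction_on with
  | H g =>
    set t : GL (Fin 2) (ZMod p) := diagOneUnit (Matrix.GeneralLinearGroup.det g)⁻¹ with ht
    have htT : t ∈ diagTorus (ZMod p) := diagOneUnit_mem_diagTorus _
    have hdet : ((g * t : GL (Fin 2) (ZMod p)) : Matrix (Fin 2) (Fin 2) (ZMod p)).det = 1 :=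
      det_mul_diagOneUnit_inv g
    let s : SL(2, ZMod p) := ⟨((g * t : GL (Fin 2) (ZMod p)) : Matrix (Fin 2) (Fin 2) (ZMod p)), hdet⟩
    have hs : Matrix.SpecialLinearGroup.toGL s = g * t := Units.ext rfl
    obtain ⟨γ, hγ⟩ := exists_redGL_eq_toGL p M hpM s
    refine ⟨γ, ?_⟩
    rw [MulAction.Quotient.smul_coe, smul_eq_mul, mul_one, hγ, hs, QuotientGroup.eq]
    simpa using htT

end FullLevel

end Literature.NumberTheory.ModularSymbols
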